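import Literature.NumberTheory.LFunctions.PrimeSumsHigherDegreeHalfPlane
import Literature.NumberTheory.Automorphic.GodementJacquetPartialL
import HarnessLib

/-!
# The Euler product over the places of degree `≥ 2` is holomorphic and non-zero on `Re s > θ + 1/2`

Topic `Literature/NumberTheory/LFunctions`; namespace `Literature.NumberTheory.LFunctions.AbelianDensity`
(as ★ `PrimeSumsHigherDegreeHalfPlane.lean`, whose thin-set count this file turns into a statement about
Euler products).  THEOREMS ONLY (no definition, no instance, no named fact, no `sorry`).  Cell
`pub/hodgecm-mathlib` (crux H413 = `stmt-HodgeConjecture-24833`), P2 toe-hold L4 «W4 THIN-PRODUCT» of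
ROAD-W v1 §2 W4 («the unramified factors … except on the thin set of places of degree `≥ 2` (absolutely
convergent, harmless)») ∕ §3(a); count-neutral.

THE STATEMENT.  Let `K` be a number field, `S` a set of finite places containing every place whose norm
`q_v = N(v)` is a rational prime (every place of residue degree `1`; inertia-degree spelling in §1∕§4), and
`α` a Satake family (★ `SatakeFamily`) whose parameters off `S` satisfy `#(α v) ≤ n` and `‖a‖ ≤ q_v^θ`.
Then the partial Euler product `L^S(s, α) = ∏'_{v ∉ S} ∏_{a ∈ α v} (1 - a q_v^{-s})⁻¹` (★
`partialStandardL S α`) **converges, is holomorphic, and does not vanish on the half-plane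
`re s > θ + 1/2`** (`differentiableOn_partialStandardL_of_prime_mem`, `hasProd_partialStandardL_of_prime_mem`).
Readings (§4): `θ = 0` (unitary parameters, `‖a‖ ≤ 1`) — half-plane `re s > 1/2`, the multiplicative form
of «`log L(s, χ) = ∑ χ(𝔭) N(𝔭)^{-s} + g(s, χ)` with `g(s, χ)` absolutely convergent for `σ > 1/2`»
[HeilbronnZetaL1967, Ch. VIII §2, Thm. 5 (PDF p. 251) and Note after Thm. 5 (PDF p. 252)]; `θ = 1/2`
(`‖a‖ ≤ q_v^{1/2}`, e.g. the Satake data `{u q^{1/2}, u q^{-1/2}, w}` of a theta-type component) —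
half-plane `re s > 1`, so the thin factor is regular and non-zero at `s = 3/2` (ROAD-W W4: the pole
bookkeeping of `L^S(s, π × μ′⁻¹)` at `s₀ = 3/2` may ignore the places of degree `≥ 2`).  HONEST NOTE for
W4: what the unknown places must supply is exactly a parameter bound `‖a‖ ≤ q_v^θ` with `θ < 1`
(`θ + 1/2 < 3/2`); the weight bound `θ = 1/2` does it, the trivial unitary bound `θ = 1` for `GL₃` does not.

THE PROOF.  §1: off `S` every place has `N(v)` not prime, so `∑_{v ∉ S} q_v^{-σ} < ∞` for `σ > 1/2` by ★
`summable_absNorm_rpow_neg_subtype_not_prime` (`Summable.comp_injective` along the inclusion).  §2: one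
factor — ★ `norm_eval_eulerPolynomial_sub_one_le` with `B = q^θ`, `t = q^{-re s}` gives
`‖P_v(s) - 1‖ ≤ (2^{#α v} - 1) q_v^{-(re s - θ)}`, and ★ `eval_eulerPolynomial_ne_zero_of_norm_mul_lt_one`
gives `P_v(s) ≠ 0` for `re s > θ`.  §3: on `re s > σ₁ > θ + 1/2` the deviations are majorised by
`(2^n - 1) q_v^{-(σ₁ - θ)}`, summable by §1, so ★ `differentiableOn_partialStandardL_of_norm_sub_one_le`
(Weierstrass `M`-test for Euler products) applies on every such half-plane and ★
`differentiableOn_halfPlane_of_forall_lt` glues; the `HasProd` statement is Mathlib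
`multipliable_one_add_of_summable` + `tprod_one_add_ne_zero_of_summable` + «the partial products of the
inverses are the inverses of the partial products» (`Filter.Tendsto.inv₀`), exactly as in ★'s proof,
exported here as the pointwise lemma `hasProd_partialStandardL_of_summable_norm_sub_one`
[JacquetShalikaAJM1981, §5, Thm. (5.3): «the infinite product … is absolutely convergent … In particular
the function … does not vanish»].  §5 records, for comparison and for the W4 twist factors, the same
argument off an ARBITRARY set of places with the full majorant `∑_v q_v^{-σ} < ∞` (`σ > 1`, ★
`summable_residueCard_rpow_neg`): half-plane `re s > θ + 1` (`differentiableOn_partialStandardL_of_norm_le_rpow`,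
`hasProd_partialStandardL_of_norm_le_rpow`).

HONEST SCOPE.  HC_CM is proved only modulo the 7 printed citations (2 remaining: hLiu418 =
stmt-HodgeConjecture-24832, h413 = stmt-HodgeConjecture-24833) until rung 0 closes; this file is a
count-neutral analytic helper (no printed statement of the summit is discharged here).

## References
* [HeilbronnZetaL1967] H. Heilbronn, *Zeta-functions and L-functions*, Ch. VIII of Cassels–Fröhlich,
  *Algebraic Number Theory* (1967), §2, Thm. 5 (PDF p. 251) and the Note after Thm. 5 (PDF p. 252).
* [JacquetShalikaAJM1981] H. Jacquet, J. Shalika, *On Euler products and the classification of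
  automorphic representations I*, Amer. J. Math. 103 (1981), §5, (5.1.3)–(5.1.4), Thm. (5.3).
* [NeukirchANT1999] J. Neukirch, *Algebraic Number Theory* (1999), Ch. I §8 (8.2); Ch. VII §13.
-/

noncomputable section

open Filter NumberField IsDedekindDomain Complex
open Literature.NumberTheory.Automorphic

open scoped Classical

namespace Literature.NumberTheory.LFunctions.AbelianDensity

variable {K : Type} [Field K] [NumberField K]

/-! ## §1 The thin majorant off a set `S` containing the degree-one places -/

/-- If `S` contains every place whose norm is a rational prime (every place of residue degree `1`),
then `∑_{v ∉ S} q_v^{-σ} < ∞` for every `σ > 1/2` (`q_v = N(v) = v.residueCard`): the complement of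
`S` lies in the thin set of places of degree `≥ 2` (★ `summable_absNorm_rpow_neg_subtype_not_prime`).
[cite: HeilbronnZetaL1967, Ch. VIII §2, Thm. 5 (PDF p. 251) and Note after Thm. 5 (PDF p. 252)] -/
theorem summable_residueCard_rpow_neg_subtype_of_prime_mem
    {S : Set (HeightOneSpectrum (𝓞 K))} (hS : ∀ v, (Ideal.absNorm v.asIdeal).Prime → v ∈ S)
    {σ : ℝ} (hσ : 1 / 2 < σ) :
    Summable fun v : {v : HeightOneSpectrum (𝓞 K) // v ∉ S} => (v.1.residueCard : ℝ) ^ (-σ) := by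
  have hi : Function.Injective (fun v : {v : HeightOneSpectrum (𝓞 K) // v ∉ S} =>
      (⟨v.1, fun h => v.2 (hS v.1 h)⟩ :
        {v : HeightOneSpectrum (𝓞 K) // ¬ (Ideal.absNorm v.asIdeal).Prime})) := by
    intro v w h
    exact Subtype.ext (congrArg Subtype.val h :)
  have h := (summable_absNorm_rpow_neg_subtype_not_prime (K := K) hσ).comp_injective hi
  refine h.congr fun v => ?_
  rfl

/-- Inertia-degree spelling of the hypothesis: if `S` contains every place of inertia degree `1`
then it contains every place whose norm is a rational prime (★ `absNorm_prime_iff_inertiaDeg_eq_one`).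
[cite: NeukirchANT1999, Ch. I §8 (8.2)] -/
theorem prime_absNorm_mem_of_inertiaDeg_eq_one_mem
    {S : Set (HeightOneSpectrum (𝓞 K))} (hS : ∀ v, v.asIdeal.inertiaDeg ℤ = 1 → v ∈ S)
    (v : HeightOneSpectrum (𝓞 K)) (hv : (Ideal.absNorm v.asIdeal).Prime) : v ∈ S :=
  hS v ((absNorm_prime_iff_inertiaDeg_eq_one v).1 hv)

/-! ## §2 One Euler factor with parameters `‖a‖ ≤ q^θ` -/

/-- `‖∏_{a ∈ α} (1 - a q^{-s}) - 1‖ ≤ (2^{#α} - 1) · q^{-(re s - θ)}` when `‖a‖ ≤ q^θ` for all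
`a ∈ α` and `re s ≥ θ` (★ `norm_eval_eulerPolynomial_sub_one_le` with `B = q^θ`, `t = q^{-re s}`).
[cite: JacquetShalikaAJM1981, §5, (5.1.3)–(5.1.4)] -/
theorem norm_eval_eulerPolynomial_cpow_neg_sub_one_le_of_norm_le_rpow {α : Multiset ℂ} {q : ℕ}
    (hq : 1 < q) {θ : ℝ} (hα : ∀ a ∈ α, ‖a‖ ≤ (q : ℝ) ^ θ) {s : ℂ} (hs : θ ≤ s.re) :
    ‖(eulerPolynomial α).eval ((q : ℂ) ^ (-s)) - 1‖ ≤
      (2 ^ Multiset.card α - 1) * (q : ℝ) ^ (-(s.re - θ)) := by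
  have hq1 : (1 : ℝ) < q := by exact_mod_cast hq
  have hq0 : (0 : ℝ) < q := zero_lt_one.trans hq1
  have hx : ‖(q : ℂ) ^ (-s)‖ ≤ (q : ℝ) ^ (-s.re) := by
    rw [norm_natCast_cpow_of_pos (zero_lt_one.trans hq), neg_re]
  have hprod : (q : ℝ) ^ θ * (q : ℝ) ^ (-s.re) = (q : ℝ) ^ (-(s.re - θ)) := by
    rw [← Real.rpow_add hq0]
    congr 1
    ring
  have hBt : (q : ℝ) ^ θ * (q : ℝ) ^ (-s.re) ≤ 1 := by
    rw [hprod]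
    exact Real.rpow_le_one_of_one_le_of_nonpos hq1.le (by linarith)
  obtain ⟨h1, -⟩ := norm_eval_eulerPolynomial_sub_one_le (Real.rpow_nonneg hq0.le θ) hx hBt α hα
  rw [hprod] at h1
  exact h1

/-- `∏_{a ∈ α} (1 - a q^{-s}) ≠ 0` when `‖a‖ ≤ q^θ` for all `a ∈ α` and `re s > θ`
(each `‖a q^{-s}‖ ≤ q^{θ - re s} < 1`; ★ `eval_eulerPolynomial_ne_zero_of_norm_mul_lt_one`).
[cite: JacquetShalikaAJM1981, §5, Thm. (5.3)] -/
theorem eval_eulerPolynomial_cpow_neg_ne_zero_of_norm_le_rpow {α : Multiset ℂ} {q : ℕ}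
    (hq : 1 < q) {θ : ℝ} (hα : ∀ a ∈ α, ‖a‖ ≤ (q : ℝ) ^ θ) {s : ℂ} (hs : θ < s.re) :
    (eulerPolynomial α).eval ((q : ℂ) ^ (-s)) ≠ 0 := by
  have hq1 : (1 : ℝ) < q := by exact_mod_cast hq
  have hq0 : (0 : ℝ) < q := zero_lt_one.trans hq1
  refine eval_eulerPolynomial_ne_zero_of_norm_mul_lt_one fun a ha => ?_
  rw [norm_mul, norm_natCast_cpow_of_pos (zero_lt_one.trans hq), neg_re]
  calc ‖a‖ * (q : ℝ) ^ (-s.re)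
      ≤ (q : ℝ) ^ θ * (q : ℝ) ^ (-s.re) := by
        gcongr
        exact hα a ha
    _ = (q : ℝ) ^ (θ - s.re) := by
        rw [← Real.rpow_add hq0]
        ring_nf
    _ < 1 := Real.rpow_lt_one_of_one_lt_of_neg hq1 (by linarith)

/-! ## §3 The thin Euler product: holomorphic and non-zero on `re s > θ + 1/2` -/

/-- **The Euler product over the places of degree `≥ 2` is holomorphic and non-vanishing on
`re s > θ + 1/2`.**  Let `S` contain every place of `K` whose norm is a rational prime and let `α`
be a Satake family whose parameters off `S` have `#(α v) ≤ n` and `‖a‖ ≤ q_v^θ` (`θ ∈ ℝ`).  Then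
`L^S(s, α) = ∏'_{v ∉ S} ∏_{a ∈ α v} (1 - a q_v^{-s})⁻¹` (★ `partialStandardL`) is holomorphic and
non-zero on `{s | θ + 1/2 < re s}`: on `re s > σ₁ > θ + 1/2` the deviations
`‖P_v(s) - 1‖ ≤ (2^n - 1) q_v^{-(σ₁ - θ)}` are summable over `v ∉ S` (the places of degree `≥ 2` are
thin), so ★ `differentiableOn_partialStandardL_of_norm_sub_one_le` applies on every such half-plane
(★ `differentiableOn_halfPlane_of_forall_lt` glues).
[cite: HeilbronnZetaL1967, Ch. VIII §2, Thm. 5 (PDF p. 251) and Note after Thm. 5 (PDF p. 252)]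
[cite: JacquetShalikaAJM1981, §5, Thm. (5.3)] -/
theorem differentiableOn_partialStandardL_of_prime_mem
    {S : Set (HeightOneSpectrum (𝓞 K))} (hS : ∀ v, (Ideal.absNorm v.asIdeal).Prime → v ∈ S)
    {α : SatakeFamily K} {θ : ℝ} {n : ℕ}
    (hcard : ∀ v, v ∉ S → Multiset.card (α v) ≤ n)
    (hα : ∀ v, v ∉ S → ∀ a ∈ α v, ‖a‖ ≤ (v.residueCard : ℝ) ^ θ) :
    DifferentiableOn ℂ (partialStandardL S α) {s : ℂ | θ + 1 / 2 < s.re} ∧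
      ∀ s : ℂ, θ + 1 / 2 < s.re → partialStandardL S α s ≠ 0 := by
  have h2n : (0 : ℝ) ≤ 2 ^ n - 1 := sub_nonneg.mpr (one_le_pow₀ (by norm_num))
  -- the estimate on `re s > σ₁`, for any `σ₁ > θ + 1/2`
  have key : ∀ σ₁ : ℝ, θ + 1 / 2 < σ₁ →
      DifferentiableOn ℂ (partialStandardL S α) {s : ℂ | σ₁ < s.re} ∧
        ∀ s : ℂ, σ₁ < s.re → partialStandardL S α s ≠ 0 := by
    intro σ₁ hσ₁
    have ht : 1 / 2 < σ₁ - θ := by linarith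
    refine differentiableOn_partialStandardL_of_norm_sub_one_le
      (u := fun v => (2 ^ n - 1) * (v.1.residueCard : ℝ) ^ (-(σ₁ - θ)))
      ((summable_residueCard_rpow_neg_subtype_of_prime_mem hS ht).mul_left (2 ^ n - 1))
      (fun v s hs => ?_) (fun v s hs => ?_)
    · -- `‖P_v(s) - 1‖ ≤ (2^{#α v} - 1) q_v^{-(re s - θ)} ≤ (2^n - 1) q_v^{-(σ₁ - θ)}`
      have hs' : σ₁ < s.re := hs
      have hq1 : (1 : ℝ) ≤ v.1.residueCard := by exact_mod_cast v.1.one_lt_residueCard.le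
      have h1 := norm_eval_eulerPolynomial_cpow_neg_sub_one_le_of_norm_le_rpow
        v.1.one_lt_residueCard (hα v.1 v.2) (s := s) (by linarith)
      refine h1.trans ?_
      have hpow : (2 : ℝ) ^ Multiset.card (α v.1) - 1 ≤ 2 ^ n - 1 :=
        sub_le_sub_right (pow_le_pow_right₀ (by norm_num) (hcard v.1 v.2)) 1
      have hq : (v.1.residueCard : ℝ) ^ (-(s.re - θ)) ≤ (v.1.residueCard : ℝ) ^ (-(σ₁ - θ)) :=
        Real.rpow_le_rpow_of_exponent_le hq1 (by linarith)
      exact mul_le_mul hpow hq (Real.rpow_nonneg (Nat.cast_nonneg _) _) h2n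
    · -- no factor vanishes: `re s > σ₁ > θ`
      have hs' : σ₁ < s.re := hs
      exact eval_eulerPolynomial_cpow_neg_ne_zero_of_norm_le_rpow v.1.one_lt_residueCard
        (hα v.1 v.2) (by linarith)
  refine ⟨differentiableOn_halfPlane_of_forall_lt fun σ₁ hσ₁ => (key σ₁ hσ₁).1, fun s hs => ?_⟩
  have h₁ : θ + 1 / 2 < (θ + 1 / 2 + s.re) / 2 := by linarith
  have h₂ : (θ + 1 / 2 + s.re) / 2 < s.re := by linarith
  exact (key _ h₁).2 s h₂

/-- **An Euler product converges wherever its deviations are summable** (pointwise form of the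
`M`-test inside ★ `differentiableOn_partialStandardL_of_norm_sub_one_le`, exported): if at `s` the local
factors `P_v(s) = ∏_{a ∈ α v} (1 - a q_v^{-s})`, `v ∉ S`, satisfy `∑_{v ∉ S} ‖P_v(s) - 1‖ < ∞` and
`P_v(s) ≠ 0`, then the inverse factors are multipliable with product `L^S(s, α)` — `partialStandardL S α s`
is the genuine value of the Euler product: `E = ∏' P_v(s) ≠ 0` (Mathlib `multipliable_one_add_of_summable`,
`tprod_one_add_ne_zero_of_summable`) and the partial products of the inverses are the inverses of the
partial products (`Filter.Tendsto.inv₀`). [cite: JacquetShalikaAJM1981, §5, Thm. (5.3)] -/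
theorem hasProd_partialStandardL_of_summable_norm_sub_one
    {S : Set (HeightOneSpectrum (𝓞 K))} {α : SatakeFamily K} {s : ℂ}
    (hsum : Summable fun v : {v : HeightOneSpectrum (𝓞 K) // v ∉ S} =>
      ‖(eulerPolynomial (α v.1)).eval ((v.1.residueCard : ℂ) ^ (-s)) - 1‖)
    (hne : ∀ v : {v : HeightOneSpectrum (𝓞 K) // v ∉ S},
      (eulerPolynomial (α v.1)).eval ((v.1.residueCard : ℂ) ^ (-s)) ≠ 0) :
    HasProd (fun v : {v : HeightOneSpectrum (𝓞 K) // v ∉ S} =>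
        ((eulerPolynomial (α v.1)).eval ((v.1.residueCard : ℂ) ^ (-s)))⁻¹)
      (partialStandardL S α s) := by
  set e : {v : HeightOneSpectrum (𝓞 K) // v ∉ S} → ℂ := fun v =>
    (eulerPolynomial (α v.1)).eval ((v.1.residueCard : ℂ) ^ (-s)) with he
  -- `E = ∏' P_v(s)` exists and is non-zero
  have hmul : Multipliable fun v => 1 + (e v - 1) := multipliable_one_add_of_summable hsum
  have hE0 : ∏' v, (1 + (e v - 1)) ≠ 0 :=
    tprod_one_add_ne_zero_of_summable (fun v => by rw [add_sub_cancel]; exact hne v) hsum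
  have hP : HasProd (fun v => 1 + (e v - 1)) (∏' v, (1 + (e v - 1))) := hmul.hasProd
  have hP₁ : HasProd e (∏' v, (1 + (e v - 1))) := by
    refine hP.congr_fun ?_
    intro v
    rw [add_sub_cancel]
  -- the partial products of the inverses are the inverses of the partial products
  have hP₂ : HasProd (fun v => (e v)⁻¹) (∏' v, (1 + (e v - 1)))⁻¹ := by
    unfold HasProd at hP₁ ⊢
    simpa only [Finset.prod_inv_distrib] using hP₁.inv₀ hE0
  have heq : partialStandardL S α s = (∏' v, (1 + (e v - 1)))⁻¹ := hP₂.tprod_eq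
  rw [heq]
  exact hP₂

/-- **The Euler product over the places of degree `≥ 2` converges there**: for `re s > θ + 1/2` the
inverse local factors off `S` are multipliable with product `L^S(s, α)`, so `partialStandardL S α s` is
the genuine value of the Euler product (not the junk value of `tprod`): `∑_{v ∉ S} ‖P_v(s) - 1‖ < ∞` by
the thin majorant, then `hasProd_partialStandardL_of_summable_norm_sub_one`.
[cite: HeilbronnZetaL1967, Ch. VIII §2, Thm. 5 (PDF p. 251) and Note after Thm. 5 (PDF p. 252)]
[cite: JacquetShalikaAJM1981, §5, Thm. (5.3)] -/
theorem hasProd_partialStandardL_of_prime_mem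
    {S : Set (HeightOneSpectrum (𝓞 K))} (hS : ∀ v, (Ideal.absNorm v.asIdeal).Prime → v ∈ S)
    {α : SatakeFamily K} {θ : ℝ} {n : ℕ}
    (hcard : ∀ v, v ∉ S → Multiset.card (α v) ≤ n)
    (hα : ∀ v, v ∉ S → ∀ a ∈ α v, ‖a‖ ≤ (v.residueCard : ℝ) ^ θ) {s : ℂ} (hs : θ + 1 / 2 < s.re) :
    HasProd (fun v : {v : HeightOneSpectrum (𝓞 K) // v ∉ S} =>
        ((eulerPolynomial (α v.1)).eval ((v.1.residueCard : ℂ) ^ (-s)))⁻¹)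
      (partialStandardL S α s) := by
  have ht : 1 / 2 < s.re - θ := by linarith
  refine hasProd_partialStandardL_of_summable_norm_sub_one ?_ fun v =>
    eval_eulerPolynomial_cpow_neg_ne_zero_of_norm_le_rpow v.1.one_lt_residueCard (hα v.1 v.2)
      (by linarith)
  -- summable deviations `‖P_v(s) - 1‖ ≤ (2^n - 1) q_v^{-(re s - θ)}`
  refine Summable.of_nonneg_of_le (fun v => norm_nonneg _) (fun v => ?_)
    ((summable_residueCard_rpow_neg_subtype_of_prime_mem hS ht).mul_left (2 ^ n - 1))
  refine (norm_eval_eulerPolynomial_cpow_neg_sub_one_le_of_norm_le_rpow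
    v.1.one_lt_residueCard (hα v.1 v.2) (s := s) (by linarith)).trans ?_
  have hpow : (2 : ℝ) ^ Multiset.card (α v.1) - 1 ≤ 2 ^ n - 1 :=
    sub_le_sub_right (pow_le_pow_right₀ (by norm_num) (hcard v.1 v.2)) 1
  exact mul_le_mul_of_nonneg_right hpow (Real.rpow_nonneg (Nat.cast_nonneg _) _)

/-! ## §4 The two readings used by ROAD-W (`θ = 0`, `θ = 1/2`) and the inertia-degree spelling -/

/-- **Unitary parameters** (`θ = 0`): if `‖a‖ ≤ 1` off `S ⊇ {degree-one places}` then `L^S(s, α)` is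
holomorphic and non-zero on `re s > 1/2` — the multiplicative form of «`g(s, χ)` is absolutely
convergent for `σ > 1/2`».
[cite: HeilbronnZetaL1967, Ch. VIII §2, Thm. 5 (PDF p. 251) and Note after Thm. 5 (PDF p. 252)] -/
theorem differentiableOn_partialStandardL_half_of_norm_le_one
    {S : Set (HeightOneSpectrum (𝓞 K))} (hS : ∀ v, (Ideal.absNorm v.asIdeal).Prime → v ∈ S)
    {α : SatakeFamily K} {n : ℕ} (hcard : ∀ v, v ∉ S → Multiset.card (α v) ≤ n)
    (hα : ∀ v, v ∉ S → ∀ a ∈ α v, ‖a‖ ≤ 1) :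
    DifferentiableOn ℂ (partialStandardL S α) {s : ℂ | 1 / 2 < s.re} ∧
      ∀ s : ℂ, 1 / 2 < s.re → partialStandardL S α s ≠ 0 := by
  have h := differentiableOn_partialStandardL_of_prime_mem hS (θ := 0) hcard
    (fun v hv a ha => by rw [Real.rpow_zero]; exact hα v hv a ha)
  simpa only [zero_add] using h

/-- **Parameters of size `≤ q_v^{1/2}`** (`θ = 1/2`; e.g. the Satake data `{u q^{1/2}, u q^{-1/2}, w}`
of a non-tempered theta-type component): `L^S(s, α)` off `S ⊇ {degree-one places}` is holomorphic and
non-zero on `re s > 1` — in particular regular and non-zero at `s = 3/2`.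
[cite: HeilbronnZetaL1967, Ch. VIII §2, Thm. 5 (PDF p. 251) and Note after Thm. 5 (PDF p. 252)] -/
theorem differentiableOn_partialStandardL_one_of_norm_le_sqrt
    {S : Set (HeightOneSpectrum (𝓞 K))} (hS : ∀ v, (Ideal.absNorm v.asIdeal).Prime → v ∈ S)
    {α : SatakeFamily K} {n : ℕ} (hcard : ∀ v, v ∉ S → Multiset.card (α v) ≤ n)
    (hα : ∀ v, v ∉ S → ∀ a ∈ α v, ‖a‖ ≤ Real.sqrt (v.residueCard : ℝ)) :
    DifferentiableOn ℂ (partialStandardL S α) {s : ℂ | 1 < s.re} ∧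
      ∀ s : ℂ, 1 < s.re → partialStandardL S α s ≠ 0 := by
  have h := differentiableOn_partialStandardL_of_prime_mem hS (θ := 1 / 2) hcard
    (fun v hv a ha => by rw [← Real.sqrt_eq_rpow]; exact hα v hv a ha)
  norm_num at h
  exact h

/-- Inertia-degree reading of the main theorem (`S ⊇ {v | f(v|p) = 1}`, ★
`not_prime_absNorm_iff_two_le_inertiaDeg`): `L^S(s, α)` is holomorphic and non-zero on
`re s > θ + 1/2`. [cite: NeukirchANT1999, Ch. VII §13, after Def. (13.1) and proof of (13.2)] -/
theorem differentiableOn_partialStandardL_of_inertiaDeg_eq_one_mem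
    {S : Set (HeightOneSpectrum (𝓞 K))} (hS : ∀ v, v.asIdeal.inertiaDeg ℤ = 1 → v ∈ S)
    {α : SatakeFamily K} {θ : ℝ} {n : ℕ}
    (hcard : ∀ v, v ∉ S → Multiset.card (α v) ≤ n)
    (hα : ∀ v, v ∉ S → ∀ a ∈ α v, ‖a‖ ≤ (v.residueCard : ℝ) ^ θ) :
    DifferentiableOn ℂ (partialStandardL S α) {s : ℂ | θ + 1 / 2 < s.re} ∧
      ∀ s : ℂ, θ + 1 / 2 < s.re → partialStandardL S α s ≠ 0 :=
  differentiableOn_partialStandardL_of_prime_mem (prime_absNorm_mem_of_inertiaDeg_eq_one_mem hS)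
    hcard hα

/-! ## §5 For comparison: off an arbitrary set of places the same bound gives the half-plane `re s > θ + 1` -/

/-- **Off an arbitrary set `S` of places** (no thinness): if the parameters off `S` have `#(α v) ≤ n` and
`‖a‖ ≤ q_v^θ`, then `L^S(s, α)` is holomorphic and non-zero on `re s > θ + 1` — the same `M`-test with
the full majorant `∑_v q_v^{-σ} < ∞` (`σ > 1`, ★ `summable_residueCard_rpow_neg`) in place of the thin
one; e.g. `θ = 0`: a twist by unitary parameters is regular and non-zero on `re s > 1` (so at `s = 3/2`).
[cite: JacquetShalikaAJM1981, §5, (5.1.3)–(5.1.4) and Thm. (5.3)] -/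
theorem differentiableOn_partialStandardL_of_norm_le_rpow
    {S : Set (HeightOneSpectrum (𝓞 K))} {α : SatakeFamily K} {θ : ℝ} {n : ℕ}
    (hcard : ∀ v, v ∉ S → Multiset.card (α v) ≤ n)
    (hα : ∀ v, v ∉ S → ∀ a ∈ α v, ‖a‖ ≤ (v.residueCard : ℝ) ^ θ) :
    DifferentiableOn ℂ (partialStandardL S α) {s : ℂ | θ + 1 < s.re} ∧
      ∀ s : ℂ, θ + 1 < s.re → partialStandardL S α s ≠ 0 := by
  have h2n : (0 : ℝ) ≤ 2 ^ n - 1 := sub_nonneg.mpr (one_le_pow₀ (by norm_num))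
  have key : ∀ σ₁ : ℝ, θ + 1 < σ₁ →
      DifferentiableOn ℂ (partialStandardL S α) {s : ℂ | σ₁ < s.re} ∧
        ∀ s : ℂ, σ₁ < s.re → partialStandardL S α s ≠ 0 := by
    intro σ₁ hσ₁
    have ht : 1 < σ₁ - θ := by linarith
    refine differentiableOn_partialStandardL_of_norm_sub_one_le
      (u := fun v => (2 ^ n - 1) * (v.1.residueCard : ℝ) ^ (-(σ₁ - θ)))
      (((summable_residueCard_rpow_neg ht).subtype _).mul_left (2 ^ n - 1))
      (fun v s hs => ?_) (fun v s hs => ?_)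
    · have hs' : σ₁ < s.re := hs
      have hq1 : (1 : ℝ) ≤ v.1.residueCard := by exact_mod_cast v.1.one_lt_residueCard.le
      refine (norm_eval_eulerPolynomial_cpow_neg_sub_one_le_of_norm_le_rpow
        v.1.one_lt_residueCard (hα v.1 v.2) (s := s) (by linarith)).trans ?_
      have hpow : (2 : ℝ) ^ Multiset.card (α v.1) - 1 ≤ 2 ^ n - 1 :=
        sub_le_sub_right (pow_le_pow_right₀ (by norm_num) (hcard v.1 v.2)) 1
      have hq : (v.1.residueCard : ℝ) ^ (-(s.re - θ)) ≤ (v.1.residueCard : ℝ) ^ (-(σ₁ - θ)) :=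
        Real.rpow_le_rpow_of_exponent_le hq1 (by linarith)
      exact mul_le_mul hpow hq (Real.rpow_nonneg (Nat.cast_nonneg _) _) h2n
    · have hs' : σ₁ < s.re := hs
      exact eval_eulerPolynomial_cpow_neg_ne_zero_of_norm_le_rpow v.1.one_lt_residueCard
        (hα v.1 v.2) (by linarith)
  refine ⟨differentiableOn_halfPlane_of_forall_lt fun σ₁ hσ₁ => (key σ₁ hσ₁).1, fun s hs => ?_⟩
  have h₁ : θ + 1 < (θ + 1 + s.re) / 2 := by linarith
  have h₂ : (θ + 1 + s.re) / 2 < s.re := by linarith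
  exact (key _ h₁).2 s h₂

/-- The Euler product off an arbitrary `S` converges on `re s > θ + 1` (genuine value of `partialStandardL`).
[cite: JacquetShalikaAJM1981, §5, Thm. (5.3)] -/
theorem hasProd_partialStandardL_of_norm_le_rpow
    {S : Set (HeightOneSpectrum (𝓞 K))} {α : SatakeFamily K} {θ : ℝ} {n : ℕ}
    (hcard : ∀ v, v ∉ S → Multiset.card (α v) ≤ n)
    (hα : ∀ v, v ∉ S → ∀ a ∈ α v, ‖a‖ ≤ (v.residueCard : ℝ) ^ θ) {s : ℂ} (hs : θ + 1 < s.re) :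
    HasProd (fun v : {v : HeightOneSpectrum (𝓞 K) // v ∉ S} =>
        ((eulerPolynomial (α v.1)).eval ((v.1.residueCard : ℂ) ^ (-s)))⁻¹)
      (partialStandardL S α s) := by
  have ht : 1 < s.re - θ := by linarith
  refine hasProd_partialStandardL_of_summable_norm_sub_one ?_ fun v =>
    eval_eulerPolynomial_cpow_neg_ne_zero_of_norm_le_rpow v.1.one_lt_residueCard (hα v.1 v.2)
      (by linarith)
  refine Summable.of_nonneg_of_le (fun v => norm_nonneg _) (fun v => ?_)
    ((((summable_residueCard_rpow_neg ht).subtype _)).mul_left (2 ^ n - 1))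
  refine (norm_eval_eulerPolynomial_cpow_neg_sub_one_le_of_norm_le_rpow
    v.1.one_lt_residueCard (hα v.1 v.2) (s := s) (by linarith)).trans ?_
  have hpow : (2 : ℝ) ^ Multiset.card (α v.1) - 1 ≤ 2 ^ n - 1 :=
    sub_le_sub_right (pow_le_pow_right₀ (by norm_num) (hcard v.1 v.2)) 1
  exact mul_le_mul_of_nonneg_right hpow (Real.rpow_nonneg (Nat.cast_nonneg _) _)

end Literature.NumberTheory.LFunctions.AbelianDensity

end
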